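import Summits.BirchSwinnertonDyer.Rank1Residual.ManinAdditive.QuarterShiftTwist
import HarnessLib
import HarnessLib.Audit.Tags

/-!
# The QUARTER-SHIFT `χ₋₄`-twist transfer, part 2: optimal rigidity FROM A ROTATION (§55.4) and the `u`-family rows (§55.5)
(cell `bsd-f2-manin`, es g34, MEMO-es §55; sibling of `QuarterShiftTwist.lean`, same flat namespace `…Rank1Residual.ManinAdditive`)

TYPER NOTE (typer g21, T-es-61 part 2).  SOURCE = HOME/es/g34/QuarterShiftTwist-es-g34.lean v2 sha16 a984591da8139a55, lines 369–685 VERBATIM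
(es's mathematics header and THEOREM 55.D live in part 1, whose module docstring describes both parts).  CONTENT: §55.4 `section Rigidity` —
an's §22 transplanted with the lattice rotation `Λ(f_{D'}) = i·Λ(f_D)` as HYPOTHESIS: `neronLattice_eq_mulLeft_of_rotation`,
`optimalTwistRigidity_of_rotation`, `c_pow_twelve_mul_Δ_eq_of_rotation` (MANIN–DISCRIMINANT identity `c′¹²·Δ(W′) = c¹²·Δ(W)`),
`maninConstant_natAbs_eq_of_rotation`, and the level-raising instances (`N(W') = 4·N(W)`, `4 ∣ N(W)`) `negOneOptimalTwistRigidity_levelRaising`,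
`negOne_optimal_c_pow_twelve_mul_Δ_eq_levelRaising`, **`maninConstant_natAbs_eq_of_Δ_eq_levelRaising`** (LEAD offer L-es-g34-1: `|c′| = |c|` when
`Δ(W′) = Δ(W)`); §55.5 `section UFamilyRows` — es's `@[conjecture]` rows (cell candidates, NOTHING ASSERTED) **E-es-163
`UFamilyCuspidalImageNonzeroAtConductorFour`**, **E-es-164 `UFamilyCuspidalImageNonzeroAtConductorSixteen`**, **S-es-g34-1 `UFamilyNegOneTwinAtSixteen`**,
**S-es-g34-1′ `UFamilyNegOneTwinAtFour`**, **S-es-g34-2 `UFamilyOptimalNegOneTwinAtSixteen`**, **E-es-165 `UFamilyManinTwinAtSixteen`**, with the kernel glue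
`uFamilyCuspidalImageNonzeroAtConductorSixteen_of` (S-1 → E-163 → E-164), `uFamilyCuspidalImageNonzeroAtConductorFour_of` (S-1′ → E-164 → E-163),
`uFamilyCuspidalImageNonzero_four_iff_sixteen` (S-1 → S-1′ → (E-163 ↔ E-164)), `uFamilyManinTwinAtSixteen_of` (S-2 → E-165), `uFamily_maninOdd_sixteen_of_four`.
All PROVED items kernel-checked (typer farm rc 0 · 0 warn · 0 sorry on v2 as a whole and on each part).  bears_on: stmt-BirchSwinnertonDyer-22967
(C2 `ManinOddAtFour`).  REFUTER: ref1 R-es-80 PENDING at landing.  PARTITION 0 · BSD is not proved by this; Manin `c = 1` is not proved by this; C2 OPEN.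
-/

noncomputable section

open scoped MatrixGroups ModularForm

open CongruenceSubgroup WeierstrassCurve
  Literature.NumberTheory.DiophantineGeometry
  Literature.NumberTheory.EllipticCurves
  Literature.NumberTheory.EllipticCurves.ModularForms

namespace Summit.BirchSwinnertonDyer.Rank1Residual.ManinAdditive

/-! ## §55.4 an's §22 transplanted: optimal rigidity and the Manin–discriminant identity FROM A ROTATION
(bodies verbatim from `NegOneOptimalTwistRigidityProof.lean`, the same-level rotation replaced by a hypothesis; arbitrary levels) -/

section Rigidity

open scoped Pointwise

/-- Lattice bookkeeping from a rotation `Λ(f_{D'}) = i·Λ(f_D)` with lattice-optimal `D`, `D'`: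
`Λ_{W'} = (c'/c)·(i⁻¹Λ_W)`. (an §22 `neronLattice_eq_mulLeft_twist_of_optimal`, rotation as hypothesis.) -/
theorem neronLattice_eq_mulLeft_of_rotation {W W' : WeierstrassCurve ℚ} [W.IsElliptic] [W'.IsElliptic]
    {N N' : ℕ} [NeZero N] [NeZero N'] (D : ModularParametrizationData W N)
    (D' : ModularParametrizationData W' N') (hD : IsLatticeOptimal D) (hD' : IsLatticeOptimal D')
    (hrot : ∀ z : ℂ, z ∈ periodLattice D'.f ↔ Complex.I * z ∈ periodLattice D.f)
    (hl0 : ((D'.c : ℂ) / (D.c : ℂ)) ≠ 0) :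
    D'.L.lattice = ((D.L.mulLeft (Complex.I)⁻¹ (inv_ne_zero Complex.I_ne_zero)).mulLeft
      ((D'.c : ℂ) / (D.c : ℂ)) hl0).lattice := by
  have hc0 : (D.c : ℂ) ≠ 0 := D.cast_c_ne_zero
  have hc0' : (D'.c : ℂ) ≠ 0 := D'.cast_c_ne_zero
  ext z
  rw [PeriodPair.mem_mulLeft_lattice, PeriodPair.mem_mulLeft_lattice, inv_inv, inv_div,
    show Complex.I * ((D.c : ℂ) / (D'.c : ℂ) * z) = (D.c : ℂ) * (Complex.I * ((D'.c : ℂ)⁻¹ * z)) by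
      rw [div_eq_mul_inv]; ring]
  constructor
  · intro hz
    obtain ⟨w, hw, rfl⟩ := hD' z hz
    rw [inv_mul_cancel_left₀ hc0']
    exact D.smul_periodLattice_le _ ((hrot w).mp hw)
  · intro hz
    obtain ⟨w, hw, hEq⟩ := hD _ hz
    have hw' : Complex.I * ((D'.c : ℂ)⁻¹ * z) = w := mul_left_cancel₀ hc0 hEq
    have hmem : (D'.c : ℂ)⁻¹ * z ∈ periodLattice D'.f := (hrot _).mpr (hw' ▸ hw)
    have := D'.smul_periodLattice_le _ hmem
    rwa [mul_inv_cancel_left₀ hc0'] at this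

/-- **Optimal rigidity from a rotation**: lattice-optimal `D`, `D'` with `Λ(f_{D'}) = i·Λ(f_D)` ⟹ `W' ≅ W ⊗ χ₋₄` over `ℚ`
(no isogeny hypothesis is needed: the Néron lattices are homothetic by a rational scalar). (an §22 verbatim.) -/
theorem optimalTwistRigidity_of_rotation {W W' : WeierstrassCurve ℚ} [W.IsElliptic] [W'.IsElliptic]
    {N N' : ℕ} [NeZero N] [NeZero N'] (D : ModularParametrizationData W N)
    (D' : ModularParametrizationData W' N') (hD : IsLatticeOptimal D) (hD' : IsLatticeOptimal D')
    (hrot : ∀ z : ℂ, z ∈ periodLattice D'.f ↔ Complex.I * z ∈ periodLattice D.f) :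
    ∃ u : VariableChange ℚ, u • W.quadraticTwist ((-1 : ℤ) : ℚ) = W' := by
  classical
  have hd0 : ((-1 : ℤ) : ℚ) ≠ 0 := by norm_num
  haveI := W.isElliptic_quadraticTwist hd0
  have hc0 : (D.c : ℂ) ≠ 0 := D.cast_c_ne_zero
  have hc0' : (D'.c : ℂ) ≠ 0 := D'.cast_c_ne_zero
  have hcq : (D.c : ℚ) ≠ 0 := by exact_mod_cast (Int.cast_ne_zero.mp hc0)
  have hcq' : (D'.c : ℚ) ≠ 0 := by exact_mod_cast (Int.cast_ne_zero.mp hc0')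
  have hlq : (D'.c : ℚ) / (D.c : ℚ) ≠ 0 := div_ne_zero hcq' hcq
  have hl0 : ((D'.c : ℂ) / (D.c : ℂ)) ≠ 0 := div_ne_zero hc0' hc0
  have hIsq : Complex.I ^ 2 = ((((-1 : ℤ) : ℚ) : ℚ) : ℂ) := by push_cast; exact Complex.I_sq
  have hLT := isNeronLatticeOf_quadraticTwist_of_sq_eq ((-1 : ℤ) : ℚ) D.isNeronLattice
    Complex.I_ne_zero hIsq
  have hΛ' := neronLattice_eq_mulLeft_of_rotation D D' hD hD' hrot hl0
  have hS' : (D'.L.lattice : Set ℂ) = (((D'.c : ℚ) / (D.c : ℚ) : ℚ) : ℂ) •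
      ((D.L.mulLeft (Complex.I)⁻¹ (inv_ne_zero Complex.I_ne_zero)).lattice.toAddSubgroup :
        Set ℂ) := by
    rw [hΛ', coe_mulLeft_lattice_eq_smul, Submodule.coe_toAddSubgroup]
    push_cast
    rfl
  have hST : ((D.L.mulLeft (Complex.I)⁻¹ (inv_ne_zero Complex.I_ne_zero)).lattice : Set ℂ) =
      ((1 : ℚ) : ℂ) • ((D.L.mulLeft (Complex.I)⁻¹ (inv_ne_zero Complex.I_ne_zero)).lattice.toAddSubgroup :
        Set ℂ) := by
    rw [Rat.cast_one, one_smul, Submodule.coe_toAddSubgroup]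
  obtain ⟨a₄, a₆, C₁, hW', hg₂, hg₃⟩ :=
    exists_shortModel_of_lattice_eq_smul D'.isNeronLattice hlq hS' (L' := _) rfl
  obtain ⟨a₄', a₆', C₂, hT, hg₂', hg₃'⟩ :=
    exists_shortModel_of_lattice_eq_smul hLT one_ne_zero hST (L' := _) rfl
  have ha₄ : a₄' = a₄ := by
    have h : (-4 : ℂ) * a₄' = -4 * a₄ := hg₂'.symm.trans hg₂
    exact_mod_cast mul_left_cancel₀ (by norm_num : (-4 : ℂ) ≠ 0) h
  have ha₆ : a₆' = a₆ := by
    have h : (-4 : ℂ) * a₆' = -4 * a₆ := hg₃'.symm.trans hg₃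
    exact_mod_cast mul_left_cancel₀ (by norm_num : (-4 : ℂ) ≠ 0) h
  rw [ha₄, ha₆] at hT
  exact ⟨C₁⁻¹ * C₂, by rw [mul_smul, hT, ← hW', inv_smul_smul]⟩

/-- **The Manin–discriminant identity from a rotation**: lattice-optimal `D`, `D'` with `Λ(f_{D'}) = i·Λ(f_D)` ⟹
`c'¹²·Δ(W') = c¹²·Δ(W)`. (an §22 verbatim.) -/
theorem c_pow_twelve_mul_Δ_eq_of_rotation {W W' : WeierstrassCurve ℚ} [W.IsElliptic] [W'.IsElliptic]
    {N N' : ℕ} [NeZero N] [NeZero N'] (D : ModularParametrizationData W N)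
    (D' : ModularParametrizationData W' N') (hD : IsLatticeOptimal D) (hD' : IsLatticeOptimal D')
    (hrot : ∀ z : ℂ, z ∈ periodLattice D'.f ↔ Complex.I * z ∈ periodLattice D.f) :
    (D'.c : ℚ) ^ 12 * W'.Δ = (D.c : ℚ) ^ 12 * W.Δ := by
  have hc0 : (D.c : ℂ) ≠ 0 := D.cast_c_ne_zero
  have hc0' : (D'.c : ℂ) ≠ 0 := D'.cast_c_ne_zero
  have hl0 : ((D'.c : ℂ) / (D.c : ℂ)) ≠ 0 := div_ne_zero hc0' hc0
  have hIsq : Complex.I ^ 2 = ((((-1 : ℤ) : ℚ) : ℚ) : ℂ) := by push_cast; exact Complex.I_sq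
  have hLT := isNeronLatticeOf_quadraticTwist_of_sq_eq ((-1 : ℤ) : ℚ) D.isNeronLattice
    Complex.I_ne_zero hIsq
  have hΛ' := neronLattice_eq_mulLeft_of_rotation D D' hD hD' hrot hl0
  have hΔ' := IsNeronLatticeOf.Δ_eq_of_lattice_eq_mulLeft D'.isNeronLattice hl0 hΛ'
  have hΛT : (D.L.mulLeft (Complex.I)⁻¹ (inv_ne_zero Complex.I_ne_zero)).lattice =
      ((D.L.mulLeft (Complex.I)⁻¹ (inv_ne_zero Complex.I_ne_zero)).mulLeft 1 one_ne_zero).lattice := by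
    ext z
    rw [PeriodPair.mem_mulLeft_lattice (c := 1), inv_one, one_mul]
  have hΔT := IsNeronLatticeOf.Δ_eq_of_lattice_eq_mulLeft hLT one_ne_zero hΛT
  rw [one_pow, inv_one, one_mul, quadraticTwist_Δ] at hΔT
  push_cast at hΔT
  have key : ((D'.c : ℂ) / (D.c : ℂ)) ^ 12 * (W'.Δ : ℂ) = (W.Δ : ℂ) := by
    rw [hΔ', ← mul_assoc, mul_inv_cancel₀ (pow_ne_zero _ hl0), one_mul, ← hΔT]; ring
  have key' : (D'.c : ℂ) ^ 12 * (W'.Δ : ℂ) = (D.c : ℂ) ^ 12 * (W.Δ : ℂ) := by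
    rw [← key, div_pow, ← mul_assoc, mul_div_cancel₀ _ (pow_ne_zero _ hc0)]
  exact_mod_cast key'

/-- `|c'| = |c|` from a rotation when the discriminants agree. -/
theorem maninConstant_natAbs_eq_of_rotation {W W' : WeierstrassCurve ℚ} [W.IsElliptic] [W'.IsElliptic]
    {N N' : ℕ} [NeZero N] [NeZero N'] (D : ModularParametrizationData W N)
    (D' : ModularParametrizationData W' N') (hD : IsLatticeOptimal D) (hD' : IsLatticeOptimal D')
    (hrot : ∀ z : ℂ, z ∈ periodLattice D'.f ↔ Complex.I * z ∈ periodLattice D.f) (hΔ : W'.Δ = W.Δ) :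
    D'.c.natAbs = D.c.natAbs := by
  have h := c_pow_twelve_mul_Δ_eq_of_rotation D D' hD hD' hrot
  rw [hΔ] at h
  have h12 : (D'.c : ℚ) ^ 12 = (D.c : ℚ) ^ 12 := mul_right_cancel₀ W.isUnit_Δ.ne_zero h
  have h12' : D'.c ^ 12 = D.c ^ 12 := by exact_mod_cast h12
  have habs : D'.c.natAbs ^ 12 = D.c.natAbs ^ 12 := by
    rw [← Int.natAbs_pow, ← Int.natAbs_pow, h12']
  exact Nat.pow_left_injective (by norm_num) habs

/-! ### The level-raising instances (`N(W') = 4·N(W)`, `4 ∣ N(W)`) -/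

/-- **E-an-10 clause 1 ACROSS LEVELS** (optimal rigidity for level-raising `χ₋₄`-pairs): lattice-optimal data at levels
`N`, `N' = 4N`, `4 ∣ N`, both curves additive at `2`, `W ⊗ χ₋₄ ~ W'` ⟹ `W ⊗ χ₋₄ ≅ W'` over `ℚ`. -/
theorem negOneOptimalTwistRigidity_levelRaising {W W' : WeierstrassCurve ℚ} [W.IsElliptic] [W'.IsElliptic]
    {N N' : ℕ} [NeZero N] [NeZero N'] (D : ModularParametrizationData W N)
    (D' : ModularParametrizationData W' N') (hD : IsLatticeOptimal D) (hD' : IsLatticeOptimal D')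
    (hN' : N' = 4 * N) (h4 : 4 ∣ N) (h4W : 2 ^ 2 ∣ W.conductorNorm ℤ) (h4W' : 2 ^ 2 ∣ W'.conductorNorm ℤ)
    (hiso : IsIsogenous (W.quadraticTwist ((-1 : ℤ) : ℚ)) W') :
    ∃ u : VariableChange ℚ, u • W.quadraticTwist ((-1 : ℤ) : ℚ) = W' :=
  optimalTwistRigidity_of_rotation D D' hD hD'
    (periodLattice_rotation_of_negOne_twist_levelRaising D D' hN' h4 h4W h4W' hiso)

/-- **The Manin–discriminant identity ACROSS LEVELS**: `c'¹²·Δ(W') = c¹²·Δ(W)` for lattice-optimal level-raising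
`χ₋₄`-pairs. -/
theorem negOne_optimal_c_pow_twelve_mul_Δ_eq_levelRaising {W W' : WeierstrassCurve ℚ} [W.IsElliptic]
    [W'.IsElliptic] {N N' : ℕ} [NeZero N] [NeZero N'] (D : ModularParametrizationData W N)
    (D' : ModularParametrizationData W' N') (hD : IsLatticeOptimal D) (hD' : IsLatticeOptimal D')
    (hN' : N' = 4 * N) (h4 : 4 ∣ N) (h4W : 2 ^ 2 ∣ W.conductorNorm ℤ) (h4W' : 2 ^ 2 ∣ W'.conductorNorm ℤ)
    (hiso : IsIsogenous (W.quadraticTwist ((-1 : ℤ) : ℚ)) W') :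
    (D'.c : ℚ) ^ 12 * W'.Δ = (D.c : ℚ) ^ 12 * W.Δ :=
  c_pow_twelve_mul_Δ_eq_of_rotation D D' hD hD'
    (periodLattice_rotation_of_negOne_twist_levelRaising D D' hN' h4 h4W h4W' hiso)

/-- **`|c′| = |c|` ACROSS LEVELS** when the (minimal) discriminants agree — Manin's conjecture at `2` TRANSFERS along
level-raising `χ₋₄`-pairs of optimal curves with `Δ′ = Δ`. -/
theorem maninConstant_natAbs_eq_of_Δ_eq_levelRaising {W W' : WeierstrassCurve ℚ} [W.IsElliptic]
    [W'.IsElliptic] {N N' : ℕ} [NeZero N] [NeZero N'] (D : ModularParametrizationData W N)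
    (D' : ModularParametrizationData W' N') (hD : IsLatticeOptimal D) (hD' : IsLatticeOptimal D')
    (hN' : N' = 4 * N) (h4 : 4 ∣ N) (h4W : 2 ^ 2 ∣ W.conductorNorm ℤ) (h4W' : 2 ^ 2 ∣ W'.conductorNorm ℤ)
    (hiso : IsIsogenous (W.quadraticTwist ((-1 : ℤ) : ℚ)) W') (hΔ : W'.Δ = W.Δ) :
    D'.c.natAbs = D.c.natAbs :=
  maninConstant_natAbs_eq_of_rotation D D' hD hD'
    (periodLattice_rotation_of_negOne_twist_levelRaising D D' hN' h4 h4W h4W' hiso) hΔ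

end Rigidity

/-! ## §55.5 The `u`-family rows (cell candidates; nothing asserted) and their kernel glue -/

section UFamilyRows

/-- **Candidate E-es-163 `UFamilyCuspidalImageNonzeroAtConductorFour`** (LAW; the `4 ∥ N` twin of the landed E-es-162,
an's binders): for a `u`-family curve with `u ≡ 1 (mod 4)` (`4 ∥ N`), SOME cusp of `X₀(N)` maps to a non-zero point of the
optimal curve, `ψ(C₀) ≠ 0` (observed: `ψ(0) = T`, i.e. `L(E_u,1)/Ω ∈ ½ + ℤ`).  BC5: PSIC0-BLIND89-v1.tsv 17921446364c1a61,
55/55 classes `N = 4(u²+4) < 5·10⁵`; FAMILY-BEYOND-v1.tsv cdfd19aedaccbb5d, 18/18 for `357 ≤ |u| ≤ 495`.  Why it might fail: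
a FLAT member (`𝓛̄_f = Λ_f`, i.e. `L(E_u,1)/Ω⁺ ∈ ℤ` and all cusps on `Λ`) beyond the tables; by THEOREM 55.D it would come with
a flat `χ₋₄`-partner at `16(u²+4)`, so E-es-162/164 fail with it. -/
@[conjecture]
def UFamilyCuspidalImageNonzeroAtConductorFour : Prop :=
  ∀ (W : WeierstrassCurve ℚ) [W.IsElliptic] [W.IsGloballyMinimal] [NeZero (W.conductorNorm ℤ)]
    (D : ModularParametrizationData W (W.conductorNorm ℤ)) (u : ℤ),
    IsUFamilyCurve W u → u % 4 = 1 → QiCuspPincer.CuspidalImageNonzero D.f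

/-- **Candidate E-es-164 `UFamilyCuspidalImageNonzeroAtConductorSixteen`** (LAW; E-es-162 pinned to the conductor, an's
binders): for a `u`-family curve with `u ≡ 3 (mod 4)` and `16 ∥ N`, `ψ(C₀) ≠ 0`.  BC5: 31/31 (PSIC0-BLIND89-v1.tsv). -/
@[conjecture]
def UFamilyCuspidalImageNonzeroAtConductorSixteen : Prop :=
  ∀ (W' : WeierstrassCurve ℚ) [W'.IsElliptic] [W'.IsGloballyMinimal] [NeZero (W'.conductorNorm ℤ)]
    (D' : ModularParametrizationData W' (W'.conductorNorm ℤ)) (u : ℤ),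
    IsUFamilyCurve W' u → u % 4 = 3 → 2 ^ 4 ∣ W'.conductorNorm ℤ → ¬ 2 ^ 5 ∣ W'.conductorNorm ℤ →
    QiCuspPincer.CuspidalImageNonzero D'.f

/-- **S-es-g34-1 `UFamilyNegOneTwinAtSixteen`** (support, FACT-SHAPED pairing row): a `u`-family curve `W'` with
`u ≡ 3 (mod 4)` and `16 ∥ N(W')` has a modular `χ₋₄`-partner `W` (a `(−u)`-family curve) at conductor `N(W')/4`.
Content = an's `UFamilyConductorLaw` (E-an-149; Tate at `2`) + the Modularity Theorem (tree
`nonempty_modularParametrizationData_of_isNewformOf`) + a global minimal model (`ord_q Δ = (8, 2) < 12`). -/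
@[conjecture]
def UFamilyNegOneTwinAtSixteen : Prop :=
  ∀ (W' : WeierstrassCurve ℚ) [W'.IsElliptic] (u : ℤ),
    IsUFamilyCurve W' u → u % 4 = 3 → 2 ^ 4 ∣ W'.conductorNorm ℤ → ¬ 2 ^ 5 ∣ W'.conductorNorm ℤ →
    ∃ (W : WeierstrassCurve ℚ) (_ : W.IsElliptic) (_ : W.IsGloballyMinimal) (_ : NeZero (W.conductorNorm ℤ))
      (_ : ModularParametrizationData W (W.conductorNorm ℤ)),
      IsUFamilyCurve W (-u) ∧ W'.conductorNorm ℤ = 4 * W.conductorNorm ℤ ∧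
      IsIsogenous (W.quadraticTwist ((-1 : ℤ) : ℚ)) W'

/-- **KERNEL GLUE (THEOREM 55.A on the family): E-es-164 ⟸ S-es-g34-1 ∧ E-es-163** — the `16 ∥ N` nonflat bit is the
`4 ∥ N` nonflat bit of the `χ₋₄`-partner, transported by the quarter shift. -/
theorem uFamilyCuspidalImageNonzeroAtConductorSixteen_of (hT : UFamilyNegOneTwinAtSixteen)
    (h4 : UFamilyCuspidalImageNonzeroAtConductorFour) : UFamilyCuspidalImageNonzeroAtConductorSixteen := by
  intro W' _ _ _ D' u hU hu h16 h32
  obtain ⟨W, _, _, _, D, hUW, hN, hiso⟩ := hT W' u hU hu h16 h32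
  have hNN' : W.conductorNorm ℤ ∣ W'.conductorNorm ℤ := ⟨4, by rw [hN]; ring⟩
  have h4W : 2 ^ 2 ∣ W.conductorNorm ℤ := by
    have h : 2 ^ 4 ∣ 4 * W.conductorNorm ℤ := hN ▸ h16
    obtain ⟨k, hk⟩ := h
    exact ⟨k, by omega⟩
  have h4W' : 2 ^ 2 ∣ W'.conductorNorm ℤ := dvd_trans (by norm_num) h16
  have h16' : 4 ^ 2 ∣ W'.conductorNorm ℤ := by norm_num at h16 ⊢; exact h16
  have hu' : (-u) % 4 = 1 := by omega
  exact cuspidalImageNonzero_of_negOne_twist_levelRaising D D' hNN' h16' h4W h4W' hiso (h4 W D (-u) hUW hu')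

/-- **S-es-g34-1′ `UFamilyNegOneTwinAtFour`** (support, FACT-SHAPED pairing row, converse direction of S-es-g34-1): a
`u`-family curve `W` with `u ≡ 1 (mod 4)` has `4 ∥ N(W)` (an's `UFamilyConductorLaw`, E-an-149) and a modular `χ₋₄`-partner `W'`
(a `(−u)`-family curve, `E_u ⊗ (−1) ≅ E_{−u}` by `x ↦ −x`) at conductor `4·N(W)` (Modularity + a global minimal model). -/
@[conjecture]
def UFamilyNegOneTwinAtFour : Prop :=
  ∀ (W : WeierstrassCurve ℚ) [W.IsElliptic] (u : ℤ),
    IsUFamilyCurve W u → u % 4 = 1 →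
    2 ^ 2 ∣ W.conductorNorm ℤ ∧ ¬ 2 ^ 3 ∣ W.conductorNorm ℤ ∧
    ∃ (W' : WeierstrassCurve ℚ) (_ : W'.IsElliptic) (_ : W'.IsGloballyMinimal) (_ : NeZero (W'.conductorNorm ℤ))
      (_ : ModularParametrizationData W' (W'.conductorNorm ℤ)),
      IsUFamilyCurve W' (-u) ∧ W'.conductorNorm ℤ = 4 * W.conductorNorm ℤ ∧
      IsIsogenous (W.quadraticTwist ((-1 : ℤ) : ℚ)) W'

/-- **KERNEL GLUE (converse transport on the family): E-es-163 ⟸ S-es-g34-1′ ∧ E-es-164** — together with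
`uFamilyCuspidalImageNonzeroAtConductorSixteen_of`: modulo the two fact-shaped pairing rows, the `4 ∥ N` law E-es-163 and the
`16 ∥ N` law E-es-164 are ONE statement (THEOREM 55.A is an `iff` along the pair). -/
theorem uFamilyCuspidalImageNonzeroAtConductorFour_of (hT : UFamilyNegOneTwinAtFour)
    (h16 : UFamilyCuspidalImageNonzeroAtConductorSixteen) : UFamilyCuspidalImageNonzeroAtConductorFour := by
  intro W _ _ _ D u hU hu
  obtain ⟨h4W, h8W, W', _, _, _, D', hUW', hN', hiso⟩ := hT W u hU hu
  have h4 : 4 ∣ W.conductorNorm ℤ := by norm_num at h4W; exact h4W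
  have h4W' : 2 ^ 2 ∣ W'.conductorNorm ℤ := by
    rw [hN']; exact dvd_mul_of_dvd_left (by norm_num) _
  have h16' : 2 ^ 4 ∣ W'.conductorNorm ℤ := by
    obtain ⟨k, hk⟩ := h4W
    rw [hN', hk]
    exact ⟨k, by ring⟩
  have h32' : ¬ 2 ^ 5 ∣ W'.conductorNorm ℤ := by
    rintro ⟨k, hk⟩
    apply h8W
    refine ⟨k, ?_⟩
    rw [hN'] at hk
    norm_num at hk ⊢
    omega
  have hu' : (-u) % 4 = 3 := by omega
  exact (cuspidalImageNonzero_iff_of_negOne_twist_levelRaising D D' hN' h4 h4W h4W' hiso).mpr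
    (h16 W' D' (-u) hUW' hu' h16' h32')

/-- The two `u`-family nonflat laws are equivalent modulo the pairing rows (THEOREM 55.A both ways). -/
theorem uFamilyCuspidalImageNonzero_four_iff_sixteen (hT : UFamilyNegOneTwinAtSixteen)
    (hT' : UFamilyNegOneTwinAtFour) :
    UFamilyCuspidalImageNonzeroAtConductorFour ↔ UFamilyCuspidalImageNonzeroAtConductorSixteen :=
  ⟨uFamilyCuspidalImageNonzeroAtConductorSixteen_of hT, uFamilyCuspidalImageNonzeroAtConductorFour_of hT'⟩

/-- **S-es-g34-2 `UFamilyOptimalNegOneTwinAtSixteen`** (support, pairing row WITH OPTIMALITY and equal discriminants):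
the `X₀`-optimal curve of a `16 ∥ N` `u`-family class (`u ≡ 3 (4)`) has a lattice-optimal `χ₋₄`-partner at `N/4`
with the same minimal discriminant (`Δ = −2⁸(u²+4)²` on both sides).  Content = S-es-g34-1 + an's E-an-50♯-type optimality of
the `(−u)`-model at `4 ∥ N` (census: `c₀ = 1`, optimal, 55/55 + 18/18). -/
@[conjecture]
def UFamilyOptimalNegOneTwinAtSixteen : Prop :=
  ∀ (W' : WeierstrassCurve ℚ) [W'.IsElliptic] [W'.IsGloballyMinimal] [NeZero (W'.conductorNorm ℤ)]
    (D' : ModularParametrizationData W' (W'.conductorNorm ℤ)) (u : ℤ),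
    IsLatticeOptimal D' → IsUFamilyCurve W' u → u % 4 = 3 → 2 ^ 4 ∣ W'.conductorNorm ℤ →
    ¬ 2 ^ 5 ∣ W'.conductorNorm ℤ →
    ∃ (W : WeierstrassCurve ℚ) (_ : W.IsElliptic) (_ : W.IsGloballyMinimal) (_ : NeZero (W.conductorNorm ℤ))
      (D : ModularParametrizationData W (W.conductorNorm ℤ)),
      IsLatticeOptimal D ∧ IsUFamilyCurve W (-u) ∧ W'.conductorNorm ℤ = 4 * W.conductorNorm ℤ ∧
      IsIsogenous (W.quadraticTwist ((-1 : ℤ) : ℚ)) W' ∧ W'.Δ = W.Δ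

/-- **Candidate E-es-165 `UFamilyManinTwinAtSixteen`** (the Manin twin law on the family): the Manin constant of the
`X₀`-optimal `16 ∥ N` `u`-family curve equals, up to sign, that of a lattice-optimal `(−u)`-family curve at `N/4`. -/
@[conjecture]
def UFamilyManinTwinAtSixteen : Prop :=
  ∀ (W' : WeierstrassCurve ℚ) [W'.IsElliptic] [W'.IsGloballyMinimal] [NeZero (W'.conductorNorm ℤ)]
    (D' : ModularParametrizationData W' (W'.conductorNorm ℤ)) (u : ℤ),
    IsLatticeOptimal D' → IsUFamilyCurve W' u → u % 4 = 3 → 2 ^ 4 ∣ W'.conductorNorm ℤ →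
    ¬ 2 ^ 5 ∣ W'.conductorNorm ℤ →
    ∃ (W : WeierstrassCurve ℚ) (_ : W.IsElliptic) (_ : W.IsGloballyMinimal) (_ : NeZero (W.conductorNorm ℤ))
      (D : ModularParametrizationData W (W.conductorNorm ℤ)),
      IsLatticeOptimal D ∧ IsUFamilyCurve W (-u) ∧ W'.conductorNorm ℤ = 4 * W.conductorNorm ℤ ∧
      D'.c.natAbs = D.c.natAbs

/-- **KERNEL GLUE (THEOREM 55.F on the family): E-es-165 ⟸ S-es-g34-2** — by `maninConstant_natAbs_eq_of_Δ_eq_levelRaising`. -/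
theorem uFamilyManinTwinAtSixteen_of (hT : UFamilyOptimalNegOneTwinAtSixteen) : UFamilyManinTwinAtSixteen := by
  intro W' _ _ _ D' u hD' hU hu h16 h32
  obtain ⟨W, _, _, _, D, hD, hUW, hN, hiso, hΔ⟩ := hT W' D' u hD' hU hu h16 h32
  have h4W : 2 ^ 2 ∣ W.conductorNorm ℤ := by
    have h : 2 ^ 4 ∣ 4 * W.conductorNorm ℤ := hN ▸ h16
    obtain ⟨k, hk⟩ := h
    exact ⟨k, by omega⟩
  have h4 : 4 ∣ W.conductorNorm ℤ := by norm_num at h4W; exact h4W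
  have h4W' : 2 ^ 2 ∣ W'.conductorNorm ℤ := dvd_trans (by norm_num) h16
  exact ⟨W, ‹_›, ‹_›, ‹_›, D, hD, hUW, hN,
    maninConstant_natAbs_eq_of_Δ_eq_levelRaising D D' hD hD' hN h4 h4W h4W' hiso hΔ⟩

/-- **C2 on the `16 ∥ N` `u`-family stratum ⟸ C2 on the `4 ∥ N` stratum** (given S-es-g34-2): if every lattice-optimal
`(−u)`-family datum at `4 ∥ N` has odd Manin constant, so does every lattice-optimal `u`-family datum at `16 ∥ N`. -/
theorem uFamily_maninOdd_sixteen_of_four (hT : UFamilyOptimalNegOneTwinAtSixteen)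
    (hodd : ∀ (W : WeierstrassCurve ℚ) [W.IsElliptic] [W.IsGloballyMinimal] [NeZero (W.conductorNorm ℤ)]
      (D : ModularParametrizationData W (W.conductorNorm ℤ)) (u : ℤ),
      IsLatticeOptimal D → IsUFamilyCurve W u → u % 4 = 1 → ¬ 2 ∣ D.c) :
    ∀ (W' : WeierstrassCurve ℚ) [W'.IsElliptic] [W'.IsGloballyMinimal] [NeZero (W'.conductorNorm ℤ)]
      (D' : ModularParametrizationData W' (W'.conductorNorm ℤ)) (u : ℤ),
      IsLatticeOptimal D' → IsUFamilyCurve W' u → u % 4 = 3 → 2 ^ 4 ∣ W'.conductorNorm ℤ →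
      ¬ 2 ^ 5 ∣ W'.conductorNorm ℤ → ¬ 2 ∣ D'.c := by
  intro W' _ _ _ D' u hD' hU hu h16 h32
  obtain ⟨W, _, _, _, D, hD, hUW, hN, habs⟩ := uFamilyManinTwinAtSixteen_of hT W' D' u hD' hU hu h16 h32
  have hu' : (-u) % 4 = 1 := by omega
  have h := hodd W D (-u) hD hUW hu'
  intro h2
  apply h
  have : (2 : ℤ).natAbs ∣ D.c.natAbs := by rw [← habs]; exact Int.natAbs_dvd_natAbs.mpr h2
  exact Int.natAbs_dvd_natAbs.mp this

end UFamilyRows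

end Summit.BirchSwinnertonDyer.Rank1Residual.ManinAdditive
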